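import Literature.AnabelianGeometry.EtaleTheta.Discharge.Sec5Prop53Toy
import HarnessLib

/-!
# [EtTh] Proposition 5.3 (i), (ii), (iii), (v), (vi) and the conjunction: the universal closures over the
# abstract §5 interface are FALSE (kernel countermodel; FACT-LIST rows F-0561, F-0562, F-0559, F-0563,
# F-0564, F-2497 — R5 «named instances only»)

Mochizuki, *The étale theta function and its Frobenioid-theoretic manifestations*, Publ. RIMS **45**
(2009), §5, Proposition 5.3, pp. 325–326 (PDF pp. 99–100) [cite: MochizukiEtTh2009, Prop 5.3 p.325 (PDF p.99)].
Cell abc-iut, block F, seat abc-iut-f-009 (unseated tranches 127–128 of `plan/F-TRANCHES.tsv`); PROOF-ONLY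
companion of abc-iut-L2-t4's `FrobenioidThetaDivisors.lean` over the toy data of `Sec5Prop53Toy.lean`
(`toyThetaDiv`: f-112's toy category with divisor monoid `⊕_{ℤ ⊔ ℤ} ℚ_{≥0}`; `toyPrimeData`,
`toyPrimeDataTwisted`; `reindex σ`). No definitions, no `sorry`.

WHAT IS PROVED. With `Ψ := 𝟭`, `ι := 𝟙`, `e := reindex σ` (so `Ψ^Φ_{A_⊚} = e`), the all-true transport stub
(`e` "is induced by `Ψ`") and the toy prime structures:
* (i) `PreservesCuspidality` FAILS for `σ = (inl 0 inr 0)`: the non-cuspidal element `x_{inl 0}` is carried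
  to the cuspidal `x_{inr 0}` (`not_forall_preservesCuspidality`, F-0561);
* the conjunction `GeometryOfDivisorsPreserved` FAILS with (i) (`not_forall_geometryOfDivisorsPreserved`, F-2497);
* (v) `PreservesNcspLabels` FAILS for `σ = (inl 0 inl 1)`: the induced permutation of `Prime^ncsp ≃ ℤ`
  (`0 ↦ 1`, `2 ↦ 2`, `3 ↦ 3`) is not `n ↦ ε·n + c` (`not_forall_preservesNcspLabels`, F-0563);
* (vi) `PreservesThetaDivisorOrbit` FAILS for `σ = (inl 0 inl 1)`: every `pullAut g` is the identity, so the
  `Aut_C(A_⊚)`-orbit of `div(Θ̈) = [x_{inl 0}]` is a singleton, which `e` moves to `[x_{inl 1}]`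
  (`not_forall_preservesThetaDivisorOrbit`, F-0564);
* (ii) `PreservesNcspComponentIsos` / (iii) `PreservesCspComponentIsos` FAIL for the TWISTED prime structure
  and `σ = (inl 0 inl 1)` / `(inr 0 inr 1)`: `Ψ^Φ(ι_{𝔭,𝔮} x_{𝔭}) = 2·x_{𝔮}` but
  `ι_{Ψ^Φ𝔭,Ψ^Φ𝔮}(Ψ^Φ x_{𝔭}) = x_{𝔮}` (`not_forall_preservesNcspComponentIsos`, F-0562;
  `not_forall_preservesCspComponentIsos`, F-0559); the hypothesis `hc` ((i) on primes) HOLDS for these `σ`.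

WHAT THIS MEANS FOR THE ROWS (R5). Prop. 5.3 is NOT a consequence of the abstract interface — print's proof
(pp. 326–327: "the well-known intersection theory of divisors supported on the chain of copies of the
projective line") is about the tempered-Frobenioid MODEL of `Ÿ̲`, which the interface cannot express, and the
stubs `T`, `𝔓` are free; the rows are admissible AT NAMED INSTANCES ONLY (no instance form exists in the
tree: the §5 model is not constructed). HONEST FRAMING: a toy datum says nothing about [EtTh] §5 itself and
nothing about [IUTchIII] Cor. 3.12; no side is taken; typed ≠ proved.
-/
namespace Literature.AnabelianGeometry.EtaleTheta

namespace FrobenioidThetaDivisors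

namespace Prop53Toy

open CategoryTheory
open Literature.AlgebraicGeometry.Frobenioids
open ConstantMultiple ConstantMultiple.Cor512Toy

/-! ### (i) `PreservesCuspidality` (F-0561) -/

/-- Prop. 5.3 (i) FAILS at the toy datum for `e = reindex (inl 0 inr 0)`: the non-cuspidal element
`x_{inl 0}` is carried to the cuspidal element `x_{inr 0}`. [cite: MochizukiEtTh2009, Prop 5.3 (i) p.325 (PDF p.99)] -/
theorem not_preservesCuspidality_toy :
    ¬ PreservesCuspidality trueTransport toyPrimeData ((CategoryTheory.Equivalence.refl : TC ≌ TC)) (Iso.refl Q)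
      (reindex swapCusp) := by
  intro h
  obtain ⟨h1, -, -⟩ := h trivial
  have hx : toyPrimeData.IsNonCuspidalElt (DirectSum.single (M := Fac) (Sum.inl 0) (Multiplicative.ofAdd 1)) := by
    intro 𝔭 hp
    rw [← primes_eq_of_mem_carrier (single_mem_carrier (Sum.inl 0)) hp]
    exact not_isCusp_P_inl 0
  have hy := (h1 _).mp hx
  rw [psiPhi_toy, reindex_single] at hy
  have hs : swapCusp (Sum.inl 0) = Sum.inr 0 := Equiv.swap_apply_left _ _
  rw [hs] at hy
  exact hy (P (Sum.inr 0)) (single_mem_carrier (Sum.inr 0)) (isCusp_P_inr 0)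

/-- **F-0561: the universal closure of `FrobenioidThetaDivisors.PreservesCuspidality` is FALSE** (R5: the
row is an assumption about NAMED §5 data, never a theorem of the interface).
[cite: MochizukiEtTh2009, Prop 5.3 (i) p.325 (PDF p.99)] -/
theorem not_forall_preservesCuspidality :
    ¬ ∀ (C : Type) [Category.{0} C] (D : Type) [Category.{0} D] (𝔉 : ThetaFrobenioid.{0} C D)
        (T : DivisorTransportStub 𝔉) (𝔓 : DivisorPrimeData 𝔉) (Ψ : C ≌ C)
        (ι : Ψ.functor.obj 𝔉.Acirc ≅ 𝔉.Acirc)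
        (e : 𝔉.PhiAcirc ≃* 𝔉.pre.Mon (𝔉.base.obj (Ψ.functor.obj 𝔉.Acirc))),
        Literature.AnabelianGeometry.EtaleTheta.FrobenioidThetaDivisors.PreservesCuspidality T 𝔓 Ψ ι e :=
  fun h => not_preservesCuspidality_toy (h TC TD toyThetaDiv trueTransport toyPrimeData _ _ _)

/-! ### The conjunction `GeometryOfDivisorsPreserved` (F-2497) -/

/-- Prop. 5.3 (all six parts, the structure `GeometryOfDivisorsPreserved`) FAILS at the toy datum (its
element-level clause (i) does). [cite: MochizukiEtTh2009, Prop 5.3 p.325–326 (PDF pp.99–100)] -/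
theorem not_geometryOfDivisorsPreserved_toy :
    ¬ GeometryOfDivisorsPreserved trueTransport toyPrimeData (CategoryTheory.Equivalence.refl : TC ≌ TC)
      (Iso.refl Q) (reindex swapCusp) := by
  intro h
  exact not_preservesCuspidality_toy fun _ => ⟨h.elements.1, h.elements.2, h.primes⟩

/-- **F-2497: the universal closure of `FrobenioidThetaDivisors.GeometryOfDivisorsPreserved` is FALSE.**
[cite: MochizukiEtTh2009, Prop 5.3 p.325–326 (PDF pp.99–100)] -/
theorem not_forall_geometryOfDivisorsPreserved :
    ¬ ∀ (C : Type) [Category.{0} C] (D : Type) [Category.{0} D] (𝔉 : ThetaFrobenioid.{0} C D)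
        (T : DivisorTransportStub 𝔉) (𝔓 : DivisorPrimeData 𝔉) (Ψ : C ≌ C)
        (ι : Ψ.functor.obj 𝔉.Acirc ≅ 𝔉.Acirc)
        (e : 𝔉.PhiAcirc ≃* 𝔉.pre.Mon (𝔉.base.obj (Ψ.functor.obj 𝔉.Acirc))),
        Literature.AnabelianGeometry.EtaleTheta.FrobenioidThetaDivisors.GeometryOfDivisorsPreserved T 𝔓 Ψ ι e :=
  fun h => not_geometryOfDivisorsPreserved_toy (h TC TD toyThetaDiv trueTransport toyPrimeData _ _ _)

/-! ### (v) `PreservesNcspLabels` (F-0563) and (vi) `PreservesThetaDivisorOrbit` (F-0564) -/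

/-- `swapNcsp` fixes every cuspidal index. [cite: MochizukiEtTh2009, Prop 5.3 (v) p.325 (PDF p.99)] -/
theorem swapNcsp_inr (n : ℤ) : swapNcsp (Sum.inr n) = Sum.inr n :=
  Equiv.swap_apply_of_ne_of_ne Sum.inr_ne_inl Sum.inr_ne_inl

/-- `swapNcsp` maps non-cuspidal indices to non-cuspidal indices. [cite: MochizukiEtTh2009, Prop 5.3 (v) p.325 (PDF p.99)] -/
theorem swapNcsp_inl (n : ℤ) : ∃ m, swapNcsp (Sum.inl n) = Sum.inl m := by
  by_cases h0 : n = 0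
  · subst h0; exact ⟨1, Equiv.swap_apply_left _ _⟩
  by_cases h1 : n = 1
  · subst h1; exact ⟨0, Equiv.swap_apply_right _ _⟩
  refine ⟨n, Equiv.swap_apply_of_ne_of_ne ?_ ?_⟩
  · exact fun h => h0 (Sum.inl_injective h)
  · exact fun h => h1 (Sum.inl_injective h)

/-- `e = reindex (inl 0 inl 1)` preserves cuspidality of primes (the hypothesis `hc` of (ii)–(v) HOLDS).
[cite: MochizukiEtTh2009, Prop 5.3 (i) p.325 (PDF p.99)] -/
theorem cuspPreserved_swapNcsp :
    CuspPreserved toyPrimeData (CategoryTheory.Equivalence.refl : TC ≌ TC) (Iso.refl Q) (reindex swapNcsp) := by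
  intro 𝔭
  change IsCusp (Primes.congr (reindex swapNcsp) 𝔭) ↔ IsCusp 𝔭
  unfold IsCusp
  rw [idx_congr_reindex]
  rcases idx 𝔭 with n | n
  · obtain ⟨m, hm⟩ := swapNcsp_inl n
    rw [hm]
    exact ⟨fun ⟨k, hk⟩ => (Sum.inl_ne_inr hk).elim, fun ⟨k, hk⟩ => (Sum.inl_ne_inr hk).elim⟩
  · rw [swapNcsp_inr]

/-- The label of `Ψ^Φ 𝔭` for `Ψ^Φ = reindex (inl 0 inl 1)` at the three non-cuspidal primes `P (inl 0)`,
`P (inl 2)`, `P (inl 3)`: `1`, `2`, `3`. [cite: MochizukiEtTh2009, Prop 5.3 (v) p.325 (PDF p.99)] -/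
theorem label_congr_swapNcsp (n m : ℤ) (h : swapNcsp (Sum.inl n) = Sum.inl m) :
    label (Primes.congr (reindex swapNcsp) (P (Sum.inl n))) = m := by
  unfold label
  rw [idx_congr_reindex, idx_P, h]
  rfl

/-- Prop. 5.3 (v) FAILS at the toy datum for `e = reindex (inl 0 inl 1)`: the induced permutation of the
labels `ℤ` (`0 ↦ 1`, `2 ↦ 2`, `3 ↦ 3`) is not of the form `n ↦ ε·n + c`.
[cite: MochizukiEtTh2009, Prop 5.3 (v) p.325 (PDF p.99)] -/
theorem not_preservesNcspLabels_toy :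
    ¬ PreservesNcspLabels toyPrimeData (CategoryTheory.Equivalence.refl : TC ≌ TC) (Iso.refl Q)
      (reindex swapNcsp) cuspPreserved_swapNcsp := by
  rintro ⟨ε, c, h⟩
  have h0 := h (P (Sum.inl 0)) (not_isCusp_P_inl 0)
  have h2 := h (P (Sum.inl 2)) (not_isCusp_P_inl 2)
  have h3 := h (P (Sum.inl 3)) (not_isCusp_P_inl 3)
  change label (Primes.congr (reindex swapNcsp) (P (Sum.inl 0))) = (ε : ℤ) * label (P (Sum.inl 0)) + c at h0
  change label (Primes.congr (reindex swapNcsp) (P (Sum.inl 2))) = (ε : ℤ) * label (P (Sum.inl 2)) + c at h2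
  change label (Primes.congr (reindex swapNcsp) (P (Sum.inl 3))) = (ε : ℤ) * label (P (Sum.inl 3)) + c at h3
  rw [label_P_inl, label_congr_swapNcsp 0 1 (Equiv.swap_apply_left _ _)] at h0
  rw [label_P_inl, label_congr_swapNcsp 2 2 (Equiv.swap_apply_of_ne_of_ne (by decide) (by decide))] at h2
  rw [label_P_inl, label_congr_swapNcsp 3 3 (Equiv.swap_apply_of_ne_of_ne (by decide) (by decide))] at h3
  omega

/-- **F-0563: the universal closure of `FrobenioidThetaDivisors.PreservesNcspLabels` is FALSE.**
[cite: MochizukiEtTh2009, Prop 5.3 (v) p.325 (PDF p.99)] -/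
theorem not_forall_preservesNcspLabels :
    ¬ ∀ (C : Type) [Category.{0} C] (D : Type) [Category.{0} D] (𝔉 : ThetaFrobenioid.{0} C D)
        (𝔓 : DivisorPrimeData 𝔉) (Ψ : C ≌ C) (ι : Ψ.functor.obj 𝔉.Acirc ≅ 𝔉.Acirc)
        (e : 𝔉.PhiAcirc ≃* 𝔉.pre.Mon (𝔉.base.obj (Ψ.functor.obj 𝔉.Acirc))) (hc : CuspPreserved 𝔓 Ψ ι e),
        Literature.AnabelianGeometry.EtaleTheta.FrobenioidThetaDivisors.PreservesNcspLabels 𝔓 Ψ ι e hc :=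
  fun h => not_preservesNcspLabels_toy (h TC TD toyThetaDiv toyPrimeData _ _ _ cuspPreserved_swapNcsp)

/-- `lift f [m] = f m` for the Grothendieck group (Mathlib's universal property, pointwise).
[folklore] -/
private theorem lift_of {M : Type*} [CommMonoid M] {G : Type*} [CommGroup G] (f : M →* G) (m : M) :
    Algebra.GrothendieckGroup.lift f (Algebra.GrothendieckGroup.of m) = f m := by
  have h := Algebra.GrothendieckGroup.lift.symm_apply_apply f
  rw [Algebra.GrothendieckGroup.lift_symm_apply] at h
  exact DFunLike.congr_fun h m

/-- `coord0 (single i a) = a` if `i = inl 0` and `= 1` otherwise (additively `0`).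
[cite: MochizukiEtTh2009, Prop 5.3 (vi) p.326 (PDF p.100)] -/
theorem coord0_single_inl_one :
    coord0 (DirectSum.single (M := Fac) (Sum.inl 1) (Multiplicative.ofAdd 1)) = 1 := by
  change AddMonoidHom.toMultiplicative _ ((DirectSum.single (M := Fac) (Sum.inl 1) (Multiplicative.ofAdd 1) : ∀ j, Fac j) (Sum.inl 0)) = 1
  rw [DirectSum.single_apply_of_ne (by decide)]
  exact map_one _

/-- `coord0 x_{inl 0} = ofAdd 1 ≠ 1`. [cite: MochizukiEtTh2009, Prop 5.3 (vi) p.326 (PDF p.100)] -/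
theorem coord0_single_inl_zero :
    coord0 (DirectSum.single (M := Fac) (Sum.inl 0) (Multiplicative.ofAdd 1)) = Multiplicative.ofAdd 1 := by
  change AddMonoidHom.toMultiplicative _ ((DirectSum.single (M := Fac) (Sum.inl 0) (Multiplicative.ofAdd 1) : ∀ j, Fac j) (Sum.inl 0)) = _
  rw [DirectSum.single_apply_same]
  rfl

/-- Prop. 5.3 (vi) FAILS at the toy datum for `e = reindex (inl 0 inl 1)`: `Aut_C(A_⊚)` acts trivially on
`Φ(A_⊚)`, so the orbit of `div(Θ̈) = [x_{inl 0}]` is `{[x_{inl 0}]}`, while `e` carries it to `[x_{inl 1}]`.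
[cite: MochizukiEtTh2009, Prop 5.3 (vi) p.326 (PDF p.100)] -/
theorem not_preservesThetaDivisorOrbit_toy :
    ¬ PreservesThetaDivisorOrbit toyPrimeData (CategoryTheory.Equivalence.refl : TC ≌ TC) (Iso.refl Q)
      (reindex swapNcsp) := by
  intro h
  -- the orbit of `div(Θ̈)` is the singleton `{[x_{inl 0}]}`
  have horb : ∀ g : Aut toyThetaDiv.Acirc,
      ThetaFrobenioid.gpMap (toyThetaDiv.pullAut g : toyThetaDiv.PhiAcirc →* toyThetaDiv.PhiAcirc)
        toyPrimeData.divTheta = toyPrimeData.divTheta := fun g =>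
    ThetaFrobenioid.gpMap_of _ _
  have hx : ThetaFrobenioid.gpMap (psiPhi toyThetaDiv (CategoryTheory.Equivalence.refl : TC ≌ TC)
      (Iso.refl Q) (reindex swapNcsp) : toyThetaDiv.PhiAcirc →* toyThetaDiv.PhiAcirc) toyPrimeData.divTheta ∈
      Set.range fun g : Aut toyThetaDiv.Acirc =>
        ThetaFrobenioid.gpMap (toyThetaDiv.pullAut g : toyThetaDiv.PhiAcirc →* toyThetaDiv.PhiAcirc)
          toyPrimeData.divTheta := by
    rw [← h]
    exact ⟨toyPrimeData.divTheta, ⟨Iso.refl _, horb _⟩, rfl⟩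
  obtain ⟨g, hg⟩ := hx
  have hg' : toyPrimeData.divTheta = _ := (horb g).symm.trans hg
  -- read in the language of the toy divisor monoid: `[x_{inl 0}] = [reindex σ x_{inl 0}]`
  change Algebra.GrothendieckGroup.of (DirectSum.single (M := Fac) (Sum.inl 0) (Multiplicative.ofAdd 1)) =
    ThetaFrobenioid.gpMap (reindex swapNcsp : Φt →* Φt)
      (Algebra.GrothendieckGroup.of (DirectSum.single (M := Fac) (Sum.inl 0) (Multiplicative.ofAdd 1))) at hg'
  rw [ThetaFrobenioid.gpMap_of] at hg'
  have hg'' := congrArg (Algebra.GrothendieckGroup.lift coord0) hg'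
  rw [lift_of, lift_of, coord0_single_inl_zero] at hg''
  change Multiplicative.ofAdd (1 : ℚ) = coord0 (reindex swapNcsp (DirectSum.single (M := Fac) (Sum.inl 0) _)) at hg''
  rw [reindex_single, show swapNcsp (Sum.inl 0) = Sum.inl 1 from Equiv.swap_apply_left _ _,
    coord0_single_inl_one] at hg''
  exact absurd (Multiplicative.ofAdd.injective (hg''.trans ofAdd_zero.symm)) one_ne_zero

/-- **F-0564: the universal closure of `FrobenioidThetaDivisors.PreservesThetaDivisorOrbit` is FALSE.**
[cite: MochizukiEtTh2009, Prop 5.3 (vi) p.326 (PDF p.100)] -/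
theorem not_forall_preservesThetaDivisorOrbit :
    ¬ ∀ (C : Type) [Category.{0} C] (D : Type) [Category.{0} D] (𝔉 : ThetaFrobenioid.{0} C D)
        (𝔓 : DivisorPrimeData 𝔉) (Ψ : C ≌ C) (ι : Ψ.functor.obj 𝔉.Acirc ≅ 𝔉.Acirc)
        (e : 𝔉.PhiAcirc ≃* 𝔉.pre.Mon (𝔉.base.obj (Ψ.functor.obj 𝔉.Acirc))),
        Literature.AnabelianGeometry.EtaleTheta.FrobenioidThetaDivisors.PreservesThetaDivisorOrbit 𝔓 Ψ ι e :=
  fun h => not_preservesThetaDivisorOrbit_toy (h TC TD toyThetaDiv toyPrimeData _ _ _)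

/-! ### (ii) `PreservesNcspComponentIsos` (F-0562), (iii) `PreservesCspComponentIsos` (F-0559):
a second prime structure whose component isomorphisms out of ONE prime are twisted by doubling -/

/-- The generator `x_i` as an element of the submonoid `Φ(A_⊚)_{P i}`. [cite: MochizukiFrdI2008, §0 p.12] -/
theorem single_mem_submonoid (i : Idx) :
    DirectSum.single (M := Fac) i (Multiplicative.ofAdd 1) ∈ (P i).submonoid :=
  Submonoid.subset_closure (single_mem_carrier i)

/-- `P i ≠ P j` for `i ≠ j`. [cite: MochizukiFrdI2008, §0 p.12] -/
theorem P_ne {i j : Idx} (h : i ≠ j) : P i ≠ P j := fun he => h (by rw [← idx_P i, he, idx_P])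

/-- `ofAdd 2 ≠ ofAdd 1` in multiplicative `ℚ_{≥0}`. [folklore] -/
private theorem q2_ne_q1 : (Multiplicative.ofAdd (2 : NNRat)) ≠ Multiplicative.ofAdd 1 := by
  rw [Ne, Multiplicative.ofAdd.injective.eq_iff]; norm_num

/-- `e = reindex (inl 0 inl 1)` preserves cuspidality of primes of the twisted structure (hypothesis `hc`).
[cite: MochizukiEtTh2009, Prop 5.3 (i) p.325 (PDF p.99)] -/
theorem cuspPreserved_twisted_swapNcsp :
    CuspPreserved toyPrimeDataTwisted (CategoryTheory.Equivalence.refl : TC ≌ TC) (Iso.refl Q)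
      (reindex swapNcsp) :=
  cuspPreserved_swapNcsp

/-- Prop. 5.3 (ii) FAILS at the toy datum with the twisted prime structure, for `e = reindex (inl 0 inl 1)`,
`𝔭 = P (inl 0)`, `𝔮 = P (inl 5)`, `x = x_{inl 0}`: `Ψ^Φ(ι_{𝔭,𝔮}(x)) = 2·x_{inl 5}` but
`ι_{Ψ^Φ𝔭, Ψ^Φ𝔮}(Ψ^Φ x) = x_{inl 5}`. [cite: MochizukiEtTh2009, Prop 5.3 (ii) p.325 (PDF p.99)] -/
theorem not_preservesNcspComponentIsos_toy :
    ¬ PreservesNcspComponentIsos toyPrimeDataTwisted (CategoryTheory.Equivalence.refl : TC ≌ TC) (Iso.refl Q)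
      (reindex swapNcsp) cuspPreserved_twisted_swapNcsp := by
  intro h
  have h05 : (Sum.inl 0 : Idx) ≠ Sum.inl 5 := by decide
  have E := h (P (Sum.inl 0)) (P (Sum.inl 5)) (not_isCusp_P_inl 0) (not_isCusp_P_inl 5) (P_ne h05)
    ⟨_, single_mem_submonoid (Sum.inl 0)⟩
  -- read `E` in the language of the toy divisor monoid
  change reindex swapNcsp ((twistIso (Sum.inl 0) (P (Sum.inl 0)) (P (Sum.inl 5))
      ⟨_, single_mem_submonoid (Sum.inl 0)⟩ : ↥(P (Sum.inl 5)).submonoid) : Φt) =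
    ((twistIso (Sum.inl 0) (Primes.congr (reindex swapNcsp) (P (Sum.inl 0)))
      (Primes.congr (reindex swapNcsp) (P (Sum.inl 5)))
      (Primes.submonoidCongr (reindex swapNcsp) (P (Sum.inl 0)) _ rfl ⟨_, single_mem_submonoid (Sum.inl 0)⟩) :
        ↥(Primes.congr (reindex swapNcsp) (P (Sum.inl 5))).submonoid) : Φt) at E
  have hσ0 : swapNcsp (Sum.inl 0) = Sum.inl 1 := Equiv.swap_apply_left _ _
  have hσ5 : swapNcsp (Sum.inl 5) = Sum.inl 5 := Equiv.swap_apply_of_ne_of_ne (by decide) (by decide)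
  rw [twistIso_val_eq (idx_P _) (idx_P _), reindex_single, hσ5,
    twistIso_val_ne (i := Sum.inl 1) (j := Sum.inl 5)
      (by rw [idx_congr_reindex, idx_P, hσ0]) (by decide) (by rw [idx_congr_reindex, idx_P, hσ5])] at E
  -- `E : x_{inl 5}(2·x₀) = x_{inl 5}((e x)(inl 1))`; evaluate at `inl 5`
  have E' := congrArg (fun f : Φt => (f : ∀ j, Fac j) (Sum.inl 5)) E
  simp only [DirectSum.single_apply_same] at E'
  rw [doubling_one] at E'
  exact q2_ne_q1 E'

/-- **F-0562: the universal closure of `FrobenioidThetaDivisors.PreservesNcspComponentIsos` is FALSE.**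
[cite: MochizukiEtTh2009, Prop 5.3 (ii) p.325 (PDF p.99)] -/
theorem not_forall_preservesNcspComponentIsos :
    ¬ ∀ (C : Type) [Category.{0} C] (D : Type) [Category.{0} D] (𝔉 : ThetaFrobenioid.{0} C D)
        (𝔓 : DivisorPrimeData 𝔉) (Ψ : C ≌ C) (ι : Ψ.functor.obj 𝔉.Acirc ≅ 𝔉.Acirc)
        (e : 𝔉.PhiAcirc ≃* 𝔉.pre.Mon (𝔉.base.obj (Ψ.functor.obj 𝔉.Acirc))) (hc : CuspPreserved 𝔓 Ψ ι e),
        Literature.AnabelianGeometry.EtaleTheta.FrobenioidThetaDivisors.PreservesNcspComponentIsos 𝔓 Ψ ι e hc :=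
  fun h => not_preservesNcspComponentIsos_toy
    (h TC TD toyThetaDiv toyPrimeDataTwisted _ _ _ cuspPreserved_twisted_swapNcsp)

/-- `e = reindex (inr 0 inr 1)` preserves cuspidality of primes of the twisted structure (hypothesis `hc`).
[cite: MochizukiEtTh2009, Prop 5.3 (i) p.325 (PDF p.99)] -/
theorem cuspPreserved_twisted_swapCsp :
    CuspPreserved toyPrimeDataTwisted (CategoryTheory.Equivalence.refl : TC ≌ TC) (Iso.refl Q)
      (reindex swapCsp) := by
  intro 𝔭
  change IsCusp (Primes.congr (reindex swapCsp) 𝔭) ↔ IsCusp 𝔭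
  unfold IsCusp
  rw [idx_congr_reindex]
  rcases idx 𝔭 with n | n
  · have : swapCsp (Sum.inl n) = Sum.inl n := Equiv.swap_apply_of_ne_of_ne Sum.inl_ne_inr Sum.inl_ne_inr
    rw [this]
  · constructor
    · rintro -; exact ⟨n, rfl⟩
    · rintro -
      by_cases h0 : n = 0
      · subst h0; exact ⟨1, Equiv.swap_apply_left _ _⟩
      by_cases h1 : n = 1
      · subst h1; exact ⟨0, Equiv.swap_apply_right _ _⟩
      exact ⟨n, Equiv.swap_apply_of_ne_of_ne (fun h => h0 (Sum.inr_injective h))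
        (fun h => h1 (Sum.inr_injective h))⟩

/-- Prop. 5.3 (iii) FAILS at the toy datum with the twisted prime structure, for `e = reindex (inr 0 inr 1)`,
`𝔭 = P (inr 0)`, `𝔮 = P (inr 5)`, `x = x_{inr 0}`. [cite: MochizukiEtTh2009, Prop 5.3 (iii) p.325 (PDF p.99)] -/
theorem not_preservesCspComponentIsos_toy :
    ¬ PreservesCspComponentIsos toyPrimeDataTwisted (CategoryTheory.Equivalence.refl : TC ≌ TC) (Iso.refl Q)
      (reindex swapCsp) cuspPreserved_twisted_swapCsp := by
  intro h
  have h05 : (Sum.inr 0 : Idx) ≠ Sum.inr 5 := by decide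
  have E := h (P (Sum.inr 0)) (P (Sum.inr 5)) (isCusp_P_inr 0) (isCusp_P_inr 5) (P_ne h05)
    ⟨_, single_mem_submonoid (Sum.inr 0)⟩
  change reindex swapCsp ((twistIso (Sum.inr 0) (P (Sum.inr 0)) (P (Sum.inr 5))
      ⟨_, single_mem_submonoid (Sum.inr 0)⟩ : ↥(P (Sum.inr 5)).submonoid) : Φt) =
    ((twistIso (Sum.inr 0) (Primes.congr (reindex swapCsp) (P (Sum.inr 0)))
      (Primes.congr (reindex swapCsp) (P (Sum.inr 5)))
      (Primes.submonoidCongr (reindex swapCsp) (P (Sum.inr 0)) _ rfl ⟨_, single_mem_submonoid (Sum.inr 0)⟩) :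
        ↥(Primes.congr (reindex swapCsp) (P (Sum.inr 5))).submonoid) : Φt) at E
  have hσ0 : swapCsp (Sum.inr 0) = Sum.inr 1 := Equiv.swap_apply_left _ _
  have hσ5 : swapCsp (Sum.inr 5) = Sum.inr 5 := Equiv.swap_apply_of_ne_of_ne (by decide) (by decide)
  rw [twistIso_val_eq (idx_P _) (idx_P _), reindex_single, hσ5,
    twistIso_val_ne (i := Sum.inr 1) (j := Sum.inr 5)
      (by rw [idx_congr_reindex, idx_P, hσ0]) (by decide) (by rw [idx_congr_reindex, idx_P, hσ5])] at E
  have E' := congrArg (fun f : Φt => (f : ∀ j, Fac j) (Sum.inr 5)) E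
  simp only [DirectSum.single_apply_same] at E'
  rw [doubling_one] at E'
  exact q2_ne_q1 E'

/-- **F-0559: the universal closure of `FrobenioidThetaDivisors.PreservesCspComponentIsos` is FALSE.**
[cite: MochizukiEtTh2009, Prop 5.3 (iii) p.325 (PDF p.99)] -/
theorem not_forall_preservesCspComponentIsos :
    ¬ ∀ (C : Type) [Category.{0} C] (D : Type) [Category.{0} D] (𝔉 : ThetaFrobenioid.{0} C D)
        (𝔓 : DivisorPrimeData 𝔉) (Ψ : C ≌ C) (ι : Ψ.functor.obj 𝔉.Acirc ≅ 𝔉.Acirc)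
        (e : 𝔉.PhiAcirc ≃* 𝔉.pre.Mon (𝔉.base.obj (Ψ.functor.obj 𝔉.Acirc))) (hc : CuspPreserved 𝔓 Ψ ι e),
        Literature.AnabelianGeometry.EtaleTheta.FrobenioidThetaDivisors.PreservesCspComponentIsos 𝔓 Ψ ι e hc :=
  fun h => not_preservesCspComponentIsos_toy
    (h TC TD toyThetaDiv toyPrimeDataTwisted _ _ _ cuspPreserved_twisted_swapCsp)

end Prop53Toy

end FrobenioidThetaDivisors

end Literature.AnabelianGeometry.EtaleTheta

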